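import Summits.Ventures.Crystal3D.Theorems.StickyWulffConstantCoaxialWallLawPayerLedger
import Summits.Ventures.Crystal3D.Theorems.StickyWulffConstantGenericWallFloorSealing
import HarnessLib

/-!
# The outer slivers are clean on the inner disc: the ledger's location lemmas WITHOUT the cleanliness hypotheses

HONEST FRAMING. Part of the venture `Summits/Ventures/Crystal3D` (cell `crystal3d-full`), helper
`--supports` the crux `CoaxialWallLaw` (stmt-Ventures-19481, `route-Ventures-StickyWulffConstant`),
REGISTERED line `WallLedgerF` (planner cf-p1 gen 16), stub `stub_coaxialTwoSlabAdhesion`.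
Plumbing for the general-filling rungs of BOTH wall lanes (planner ROUTE §79b–d): lane G's ledger lemmas
`foreign_high_or_rim`, `not_outerCredit_of_foreign` (`…GrainCredits`), `mem_sample_bottom_of_deep`
(`…ExitLocation`), their `_top` mirrors (`…TopCredits`) and this seat's `slot_mem_of_full_shell_bottom_of_nonneg`
(`…CoaxialWallLawPayerLedger`) carry the CLEAN-SLIVER hypotheses
`∀ p ∈ X, p₂ < −2R₀ + 1 → p ∈ Λ₁` / `∀ p ∈ X, p₂ > h + 2R₀ − 1 → p ∈ Λ₂`, which the stubs
`TwoSlabAdhesion` / `CoaxialTwoSlabAdhesion` do not have.  Every use of them is at a ball OFF THE RIM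
(lateral radius `≤ ρ − 1`), where cleanliness is a THEOREM of the cell: wulff-p2's one-sided covering /
sealing lemmas `sealing_below` / `sealing_above` (`…GenericWallFloorSealing`: a ball of `X` off the sample
inside `[a, b − 1] × disc (ρ − 1)` resp. `[a + 1, b] × disc (ρ − 1)` contradicts completeness + unit
separation).  This file re-proves the seven lemmas with the cleanliness hypothesis REPLACED by the cell's
floor/ceiling (`_sealed` versions, same conclusions); the next files rebuild the restricted-payer ledger and
the co-axial rungs on them, so that their hypothesis lists are EXACTLY the stub's.  Rung credit only;
F-C1 not moved.

WHAT THIS IS NOT: no new mathematics (sealing is wulff-p2's); F-C1 not moved.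
-/

noncomputable section

namespace Summit.Ventures.Crystal3D.Theorems

open Summit.Ventures.Crystal3D Finset
open Literature.MathematicalPhysics.StatisticalMechanics (fccStacking)
open scoped InnerProductSpace

/-! ### Bottom sample -/

/-- **A foreign ball is high or in the rim zone** — sealed form (no clean-sliver hypothesis; the cell
floor `−2R₀ ≤ p₂` instead). -/
theorem foreign_high_or_rim_sealed
    (A : EuclideanSpace ℝ (Fin 3) ≃ₗᵢ[ℝ] EuclideanSpace ℝ (Fin 3)) (t : EuclideanSpace ℝ (Fin 3))
    (X P : Finset (EuclideanSpace ℝ (Fin 3))) (R₀ ρ : ℝ) (hρ : 1 ≤ ρ)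
    (hX : ∀ p ∈ X, ∀ q ∈ X, p ≠ q → 1 ≤ dist p q) (hPX : P ⊆ X)
    (hfloor : ∀ p ∈ X, -(2 * R₀) ≤ p 2)
    (hP : ∀ p, p ∈ P ↔ (p ∈ (fun q => A q + t) '' fccStacking 1 (Real.sqrt (2 / 3)) ∧
      -(2 * R₀) ≤ p 2 ∧ p 2 ≤ -R₀ ∧ p 0 ^ 2 + p 1 ^ 2 ≤ ρ ^ 2))
    {q : EuclideanSpace ℝ (Fin 3)} (hqX : q ∈ X)
    (hqΛ : q ∉ (fun q => A q + t) '' fccStacking 1 (Real.sqrt (2 / 3))) :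
    -R₀ - 1 < q 2 ∨ (ρ - 1) ^ 2 < q 0 ^ 2 + q 1 ^ 2 := by
  by_contra hcon
  push Not at hcon
  obtain ⟨hq2, hqr⟩ := hcon
  have hqP : q ∉ P := fun h => hqΛ ((hP q).1 h).1
  exact sealing_below A t (-(2 * R₀)) (-R₀) ρ hρ X P hX hPX hP q hqX hqP (hfloor q hqX) (by linarith) hqr

/-- **A non-rim sample ball touching a foreign ball carries no outer credit** — sealed form. -/
theorem not_outerCredit_of_foreign_sealed
    (A : EuclideanSpace ℝ (Fin 3) ≃ₗᵢ[ℝ] EuclideanSpace ℝ (Fin 3)) (t : EuclideanSpace ℝ (Fin 3))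
    (X P : Finset (EuclideanSpace ℝ (Fin 3))) (R₀ ρ : ℝ) (hR₀ : 3 ≤ R₀) (hρ : R₀ ≤ ρ)
    (hX : ∀ p ∈ X, ∀ q ∈ X, p ≠ q → 1 ≤ dist p q) (hPX : P ⊆ X)
    (hfloor : ∀ p ∈ X, -(2 * R₀) ≤ p 2)
    (hP : ∀ p, p ∈ P ↔ (p ∈ (fun q => A q + t) '' fccStacking 1 (Real.sqrt (2 / 3)) ∧
      -(2 * R₀) ≤ p 2 ∧ p 2 ≤ -R₀ ∧ p 0 ^ 2 + p 1 ^ 2 ≤ ρ ^ 2))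
    {p q : EuclideanSpace ℝ (Fin 3)} (hp : p ∈ P) (hprim : p 0 ^ 2 + p 1 ^ 2 ≤ (ρ - 2) ^ 2)
    (hqX : q ∈ X) (hqΛ : q ∉ (fun q => A q + t) '' fccStacking 1 (Real.sqrt (2 / 3)))
    (hpq : dist p q = 1)
    {w : EuclideanSpace ℝ (Fin 3)} (hw : w ∈ fccSlots)
    (hα : ⟪A w, EuclideanSpace.single (2 : Fin 3) (1 : ℝ)⟫_ℝ ≤ 0) : p + A w ∈ P := by
  have hρ1 : (1 : ℝ) ≤ ρ := by linarith
  have hρ2 : (0 : ℝ) ≤ ρ - 2 := by linarith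
  obtain ⟨hpΛ, hp1, hp2, hp3⟩ := (hP p).1 hp
  have hsp : Real.sqrt (p 0 ^ 2 + p 1 ^ 2) ≤ ρ - 2 := by
    rw [← Real.sqrt_sq hρ2]; exact Real.sqrt_le_sqrt hprim
  have hlatw : (p + A w) 0 ^ 2 + (p + A w) 1 ^ 2 ≤ ρ ^ 2 := by
    have h1 := sqrt_lateral_add_le p (A w)
    rw [LinearIsometryEquiv.norm_map, norm_eq_one_of_mem_fccSlots hw] at h1
    have h2 : Real.sqrt ((p + A w) 0 ^ 2 + (p + A w) 1 ^ 2) ≤ ρ := by linarith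
    have h3 := Real.sq_sqrt (by positivity : (0 : ℝ) ≤ (p + A w) 0 ^ 2 + (p + A w) 1 ^ 2)
    nlinarith [Real.sqrt_nonneg ((p + A w) 0 ^ 2 + (p + A w) 1 ^ 2)]
  rcases foreign_high_or_rim_sealed A t X P R₀ ρ hρ1 hX hPX hfloor hP hqX hqΛ with hq2 | hqr
  · have hpz : -R₀ - 2 < p 2 := by
      have := abs_apply_sub_le_dist p q 2
      rw [hpq] at this
      have := (abs_le.1 this).1
      linarith
    have hα1 : -1 ≤ ⟪A w, EuclideanSpace.single (2 : Fin 3) (1 : ℝ)⟫_ℝ :=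
      (abs_le.1 (abs_inner_slot_le_one A hw)).1
    have e2 : (p + A w) 2 = p 2 + ⟪A w, EuclideanSpace.single (2 : Fin 3) (1 : ℝ)⟫_ℝ := by
      rw [PiLp.add_apply, apply_two_eq_inner_e₃ (A w)]
    rw [hP]
    refine ⟨movedFcc_add_site_mem A t hpΛ (mem_fcc_of_mem_fccSlots hw), ?_, ?_, hlatw⟩
    · rw [e2]; linarith
    · rw [e2]; linarith
  · exfalso
    have h1 := lateral_radius_le_add_dist q p
    rw [dist_comm, hpq] at h1
    have hq : ρ - 1 < Real.sqrt (q 0 ^ 2 + q 1 ^ 2) := by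
      rw [← Real.sqrt_sq (by linarith : (0 : ℝ) ≤ ρ - 1)]
      exact Real.sqrt_lt_sqrt (sq_nonneg _) hqr
    linarith

/-- A ball of `X` deep inside the bottom clamped slab region is a ball of the sample — sealed form. -/
theorem mem_sample_bottom_of_deep_sealed
    (A : EuclideanSpace ℝ (Fin 3) ≃ₗᵢ[ℝ] EuclideanSpace ℝ (Fin 3)) (t : EuclideanSpace ℝ (Fin 3))
    (X P : Finset (EuclideanSpace ℝ (Fin 3))) (R₀ ρ : ℝ) (hR₀ : 3 ≤ R₀) (hρ : R₀ ≤ ρ)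
    (hX : ∀ p ∈ X, ∀ q ∈ X, p ≠ q → 1 ≤ dist p q) (hPX : P ⊆ X)
    (hcell : ∀ p ∈ X, -(2 * R₀) ≤ p 2)
    (hP : ∀ p, p ∈ P ↔ (p ∈ (fun q => A q + t) '' fccStacking 1 (Real.sqrt (2 / 3)) ∧
      -(2 * R₀) ≤ p 2 ∧ p 2 ≤ -R₀ ∧ p 0 ^ 2 + p 1 ^ 2 ≤ ρ ^ 2))
    {q : EuclideanSpace ℝ (Fin 3)} (hq : q ∈ X) (hq2 : q 2 ≤ -R₀ - 1) (hqr : q 0 ^ 2 + q 1 ^ 2 ≤ (ρ - 1) ^ 2) :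
    q ∈ P := by
  have hρ1 : (1 : ℝ) ≤ ρ := by linarith
  by_contra hqP
  exact sealing_below A t (-(2 * R₀)) (-R₀) ρ hρ1 X P hX hPX hP q hq hqP (hcell q hq) (by linarith) hqr

/-- **Own-grain exits along a non-descending slot are not born deep in the bottom slab** — sealed form
of `slot_mem_of_full_shell_bottom_of_nonneg`. -/
theorem slot_mem_of_full_shell_bottom_of_nonneg_sealed
    (A : EuclideanSpace ℝ (Fin 3) ≃ₗᵢ[ℝ] EuclideanSpace ℝ (Fin 3)) (t : EuclideanSpace ℝ (Fin 3))
    (X P : Finset (EuclideanSpace ℝ (Fin 3))) (R₀ ρ : ℝ) (hR₀ : 3 ≤ R₀) (hρ : R₀ ≤ ρ)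
    (hX : ∀ p ∈ X, ∀ q ∈ X, p ≠ q → 1 ≤ dist p q) (hPX : P ⊆ X)
    (hcell : ∀ p ∈ X, -(2 * R₀) ≤ p 2)
    (hP : ∀ p, p ∈ P ↔ (p ∈ (fun q => A q + t) '' fccStacking 1 (Real.sqrt (2 / 3)) ∧
      -(2 * R₀) ≤ p 2 ∧ p 2 ≤ -R₀ ∧ p 0 ^ 2 + p 1 ^ 2 ≤ ρ ^ 2))
    {d : EuclideanSpace ℝ (Fin 3)} (hd : d ∈ X) (hfull : ∀ w ∈ fccSlots, d + A w ∈ X) (hd2 : d 2 ≤ -R₀ - 3)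
    (hdr : d 0 ^ 2 + d 1 ^ 2 ≤ (ρ - 2) ^ 2) {u v : EuclideanSpace ℝ (Fin 3)} (hu : u ∈ fccSlots)
    (hup : 0 ≤ ⟪A u, EuclideanSpace.single (2 : Fin 3) (1 : ℝ)⟫_ℝ) (hv : v ∈ fccSlots) :
    d + A u + A v ∈ X := by
  have hρ2 : (0 : ℝ) ≤ ρ - 2 := by linarith
  have hdP : d ∈ P := mem_sample_bottom_of_deep_sealed A t X P R₀ ρ hR₀ hρ hX hPX hcell hP hd (by linarith)
    (by nlinarith)
  have hdΛ := ((hP d).1 hdP).1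
  have hlow : -(2 * R₀) ≤ d 2 + ⟪A v, EuclideanSpace.single (2 : Fin 3) (1 : ℝ)⟫_ℝ := by
    have hmem := hfull v hv
    have h2 : (d + A v) 2 = d 2 + ⟪A v, EuclideanSpace.single (2 : Fin 3) (1 : ℝ)⟫_ℝ := by
      rw [PiLp.add_apply, apply_two_eq_inner_e₃ (A v)]
    have := hcell _ hmem
    rwa [h2] at this
  have hαu := abs_le.1 (abs_inner_slot_le_one A hu)
  have hαv := abs_le.1 (abs_inner_slot_le_one A hv)
  have h2 : (d + A u + A v) 2 = d 2 + ⟪A u, EuclideanSpace.single (2 : Fin 3) (1 : ℝ)⟫_ℝ +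
      ⟪A v, EuclideanSpace.single (2 : Fin 3) (1 : ℝ)⟫_ℝ := by
    rw [PiLp.add_apply, PiLp.add_apply, apply_two_eq_inner_e₃ (A u), apply_two_eq_inner_e₃ (A v)]
  have hlat : (d + A u + A v) 0 ^ 2 + (d + A u + A v) 1 ^ 2 ≤ ρ ^ 2 := by
    have h1 := lateral_sq_add_le d (A u) hρ2 hdr
    rw [LinearIsometryEquiv.norm_map, norm_eq_one_of_mem_fccSlots hu, show ρ - 2 + 1 = ρ - 1 by ring] at h1
    have h3 := lateral_sq_add_le (d + A u) (A v) (by linarith) h1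
    rw [LinearIsometryEquiv.norm_map, norm_eq_one_of_mem_fccSlots hv, show ρ - 1 + 1 = ρ by ring] at h3
    exact h3
  refine hPX ((hP _).2 ⟨?_, by rw [h2]; linarith, by rw [h2]; linarith, hlat⟩)
  exact movedFcc_add_site_mem A t (movedFcc_add_site_mem A t hdΛ (mem_fcc_of_mem_fccSlots hu))
    (mem_fcc_of_mem_fccSlots hv)

/-- **No own-grain exit along a non-descending slot within three of a bottom-layer ball** — sealed form. -/
theorem slots_full_of_near_bottom_layer_of_nonneg_sealed
    (A : EuclideanSpace ℝ (Fin 3) ≃ₗᵢ[ℝ] EuclideanSpace ℝ (Fin 3)) (t : EuclideanSpace ℝ (Fin 3))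
    (X P : Finset (EuclideanSpace ℝ (Fin 3))) (R₀ ρ : ℝ) (hR₀ : 8 ≤ R₀) (hρ : R₀ ≤ ρ)
    (hX : ∀ p ∈ X, ∀ q ∈ X, p ≠ q → 1 ≤ dist p q) (hPX : P ⊆ X)
    (hcell : ∀ p ∈ X, -(2 * R₀) ≤ p 2)
    (hP : ∀ p, p ∈ P ↔ (p ∈ (fun q => A q + t) '' fccStacking 1 (Real.sqrt (2 / 3)) ∧
      -(2 * R₀) ≤ p 2 ∧ p 2 ≤ -R₀ ∧ p 0 ^ 2 + p 1 ^ 2 ≤ ρ ^ 2))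
    {u : EuclideanSpace ℝ (Fin 3)} (hu : u ∈ fccSlots)
    (hup : 0 ≤ ⟪A u, EuclideanSpace.single (2 : Fin 3) (1 : ℝ)⟫_ℝ)
    {e y : EuclideanSpace ℝ (Fin 3)} (hd : e - A u ∈ X) (hfull : ∀ w ∈ fccSlots, e - A u + A w ∈ X)
    (hylow : y 2 < -(2 * R₀) + 1) (hyr : y 0 ^ 2 + y 1 ^ 2 ≤ (ρ - 8) ^ 2) (hdist : dist e y ≤ 3)
    {v : EuclideanSpace ℝ (Fin 3)} (hv : v ∈ fccSlots) : e + A v ∈ X := by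
  have hAu : ‖A u‖ = 1 := by rw [LinearIsometryEquiv.norm_map, norm_eq_one_of_mem_fccSlots hu]
  obtain ⟨hlat, hz, -⟩ := pred_near (by linarith) hdist hAu hyr
  have hmem := slot_mem_of_full_shell_bottom_of_nonneg_sealed A t X P R₀ ρ (by linarith) hρ hX hPX hcell hP
    hd hfull (by linarith) hlat hu hup hv
  rwa [sub_add_cancel] at hmem

/-! ### Top sample -/

/-- **A foreign ball is low or in the rim zone (top sample)** — sealed form (the cell ceiling
`p₂ ≤ h + 2R₀` instead of the clean top sliver). -/
theorem foreign_low_or_rim_top_sealed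
    (A : EuclideanSpace ℝ (Fin 3) ≃ₗᵢ[ℝ] EuclideanSpace ℝ (Fin 3)) (t : EuclideanSpace ℝ (Fin 3))
    (X P : Finset (EuclideanSpace ℝ (Fin 3))) (R₀ h ρ : ℝ) (hρ : 1 ≤ ρ)
    (hX : ∀ p ∈ X, ∀ q ∈ X, p ≠ q → 1 ≤ dist p q) (hPX : P ⊆ X)
    (hceil : ∀ p ∈ X, p 2 ≤ h + 2 * R₀)
    (hP : ∀ p, p ∈ P ↔ (p ∈ (fun q => A q + t) '' fccStacking 1 (Real.sqrt (2 / 3)) ∧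
      h + R₀ ≤ p 2 ∧ p 2 ≤ h + 2 * R₀ ∧ p 0 ^ 2 + p 1 ^ 2 ≤ ρ ^ 2))
    {q : EuclideanSpace ℝ (Fin 3)} (hqX : q ∈ X)
    (hqΛ : q ∉ (fun q => A q + t) '' fccStacking 1 (Real.sqrt (2 / 3))) :
    q 2 < h + R₀ + 1 ∨ (ρ - 1) ^ 2 < q 0 ^ 2 + q 1 ^ 2 := by
  by_contra hcon
  push Not at hcon
  obtain ⟨hq2, hqr⟩ := hcon
  have hqP : q ∉ P := fun h => hqΛ ((hP q).1 h).1
  exact sealing_above A t (h + R₀) (h + 2 * R₀) ρ hρ X P hX hPX hP q hqX hqP (by linarith) (hceil q hqX) hqr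

/-- **A non-rim top-sample ball touching a foreign ball carries no outer credit** — sealed form. -/
theorem not_outerCredit_of_foreign_top_sealed
    (A : EuclideanSpace ℝ (Fin 3) ≃ₗᵢ[ℝ] EuclideanSpace ℝ (Fin 3)) (t : EuclideanSpace ℝ (Fin 3))
    (X P : Finset (EuclideanSpace ℝ (Fin 3))) (R₀ h ρ : ℝ) (hR₀ : 3 ≤ R₀) (hρ : R₀ ≤ ρ)
    (hX : ∀ p ∈ X, ∀ q ∈ X, p ≠ q → 1 ≤ dist p q) (hPX : P ⊆ X)
    (hceil : ∀ p ∈ X, p 2 ≤ h + 2 * R₀)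
    (hP : ∀ p, p ∈ P ↔ (p ∈ (fun q => A q + t) '' fccStacking 1 (Real.sqrt (2 / 3)) ∧
      h + R₀ ≤ p 2 ∧ p 2 ≤ h + 2 * R₀ ∧ p 0 ^ 2 + p 1 ^ 2 ≤ ρ ^ 2))
    {p q : EuclideanSpace ℝ (Fin 3)} (hp : p ∈ P) (hprim : p 0 ^ 2 + p 1 ^ 2 ≤ (ρ - 2) ^ 2)
    (hqX : q ∈ X) (hqΛ : q ∉ (fun q => A q + t) '' fccStacking 1 (Real.sqrt (2 / 3)))
    (hpq : dist p q = 1)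
    {w : EuclideanSpace ℝ (Fin 3)} (hw : w ∈ fccSlots)
    (hα : 0 ≤ ⟪A w, EuclideanSpace.single (2 : Fin 3) (1 : ℝ)⟫_ℝ) : p + A w ∈ P := by
  have hρ1 : (1 : ℝ) ≤ ρ := by linarith
  have hρ2 : (0 : ℝ) ≤ ρ - 2 := by linarith
  obtain ⟨hpΛ, hp1, hp2, hp3⟩ := (hP p).1 hp
  have hsp : Real.sqrt (p 0 ^ 2 + p 1 ^ 2) ≤ ρ - 2 := by
    rw [← Real.sqrt_sq hρ2]; exact Real.sqrt_le_sqrt hprim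
  have hlatw : (p + A w) 0 ^ 2 + (p + A w) 1 ^ 2 ≤ ρ ^ 2 := by
    have h1 := sqrt_lateral_add_le p (A w)
    rw [LinearIsometryEquiv.norm_map, norm_eq_one_of_mem_fccSlots hw] at h1
    have h2 : Real.sqrt ((p + A w) 0 ^ 2 + (p + A w) 1 ^ 2) ≤ ρ := by linarith
    have h3 := Real.sq_sqrt (by positivity : (0 : ℝ) ≤ (p + A w) 0 ^ 2 + (p + A w) 1 ^ 2)
    have h4 : (0 : ℝ) ≤ Real.sqrt ((p + A w) 0 ^ 2 + (p + A w) 1 ^ 2) := Real.sqrt_nonneg _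
    nlinarith
  rcases foreign_low_or_rim_top_sealed A t X P R₀ h ρ hρ1 hX hPX hceil hP hqX hqΛ with hq2 | hqr
  · have hpz : p 2 < h + R₀ + 2 := by
      have := abs_apply_sub_le_dist p q 2
      rw [hpq] at this
      have := (abs_le.1 this).2
      linarith
    have hα1 : ⟪A w, EuclideanSpace.single (2 : Fin 3) (1 : ℝ)⟫_ℝ ≤ 1 :=
      (abs_le.1 (abs_inner_slot_le_one A hw)).2
    have e2 : (p + A w) 2 = p 2 + ⟪A w, EuclideanSpace.single (2 : Fin 3) (1 : ℝ)⟫_ℝ := by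
      rw [PiLp.add_apply, apply_two_eq_inner_e₃ (A w)]
    rw [hP]
    refine ⟨movedFcc_add_site_mem A t hpΛ (mem_fcc_of_mem_fccSlots hw), ?_, ?_, hlatw⟩
    · rw [e2]; linarith
    · rw [e2]; linarith
  · exfalso
    have h1 := lateral_radius_le_add_dist q p
    rw [dist_comm, hpq] at h1
    have hq : ρ - 1 < Real.sqrt (q 0 ^ 2 + q 1 ^ 2) := by
      rw [← Real.sqrt_sq (by linarith : (0 : ℝ) ≤ ρ - 1)]
      exact Real.sqrt_lt_sqrt (sq_nonneg _) hqr
    linarith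

end Summit.Ventures.Crystal3D.Theorems

end
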